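import Summits.BirchSwinnertonDyer.BirchSwinnertonDyer.Theorems.ByReductionTypeAtTwoFineSelmerConjAAtTwoAdditivePotGoodCubicPencilWindowRegimes
import HarnessLib

/-!
# Route `ByReductionTypeAtTwo` (rung K4), crux C1″ `FineSelmerConjAAtTwoAdditivePotGood` (item stmt-BirchSwinnertonDyer-22615):
# WINDOW MEMBERS OF THE CUBIC PENCIL — the two infinite rows: the DEGENERATE row `(v₂a, v₂b) = (0, 1)`, `v₂D ≥ 7`
# (member `t₀ + 2^m`) and the ISOLATED-ROOT row `v₂ b = 0`, `a = 0 ∨ v₂ a ≥ 2` (an odd `t ≤ 15` with `v₂ f(t) = 3`)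
# (a `--supports 22615` file; seat `bsd-2adic-k4-w1` GEN 3; sequel of `…CubicPencilWindowRegimes`; 2-adic valuation arithmetic only)

HONEST FRAMING (cell `bsd-2adic`, D-0036/D-0054): types-the-object-of; closes nothing; nothing booked; BSD is not proved by any
of this. KERNEL-ONLY.

* §1 «unit + unit is even» (`p = 2`): `v₂ x = v₂ y ⟹ v₂(x + y) ≥ v₂ x + 1` (or `x + y = 0`).
* §2 DEGENERATE ROW (`a` odd-valued `0`, `v₂ b = 1`, `Δ = v₂(4a³ + 27b²) ≥ 7`: two `2`-adically close roots): with
  `t₀ = −3b/(2a)` and `δ = 2^m` the EXACT expansions `Q(t₀ + δ) = 3aδ² − D/(4a)`, `f(t₀ + δ) = δ²(3t₀ + δ) + D(2aδ − b)/(8a³)`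
  give `v₂ Q = v₂ f = 2m` for `2m < Δ − 2`, value `8 + 2m − Δ`; `m = (Δ − 6)/2` (value `2`) or `(Δ − 3)/2` (value `5`).
* §3 ISOLATED-ROOT ROW (`v₂ b = 0`, `a = 0` or `v₂ a ≥ 2`: `f ≡ (X + 1)(X² + X + 1) (mod 2)`): `f` is an isometry on odd
  `t` (`v₂(f(t + 2^k) − f(t)) = k`), so walking `t = 1 → 1 + 2^{v} → …` reaches an odd `t ≤ 15` with `v₂ f(t) = 3`; there
  `v₂ Q(t) = 0`, `Δ = 0`, value `8 − 6 = 2`.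

With `…CubicPencilWindowRegimes` every normalised `(v₂ a, v₂ b)` has a window member; assembly + IFF: `…CurveFreeIff`.
References: [SilvermanAEC2009] VII.1.1; [Iwasawa1973MuInvariants] §3.
-/

set_option autoImplicit false
-- sibling precedent (`…CubicPencilWindowRegimes.lean`): the directory name repeats the summit name
set_option linter.dupNamespace false

noncomputable section

open scoped Classical

namespace Summit.BirchSwinnertonDyer.BirchSwinnertonDyer.Theorems.AddKatoTwo

/-! ## §1 «unit + unit is even» at `p = 2` -/

section UnitSum

/-- Integers of the same `2`-adic valuation `K` sum to valuation `≥ K + 1` (or to `0`): `2^K(odd + odd) = 2^{K+1}·(…)`. -/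
theorem padicValInt_add_of_eq {P R : ℤ} (hP : P ≠ 0) (hR : R ≠ 0) (hPR : P + R ≠ 0)
    (h : padicValInt 2 P = padicValInt 2 R) : padicValInt 2 P + 1 ≤ padicValInt 2 (P + R) := by
  set K := padicValInt 2 P with hK
  obtain ⟨P', hP'⟩ : (2 : ℤ) ^ K ∣ P := by exact_mod_cast padicValInt_dvd (p := 2) P
  obtain ⟨R', hR'⟩ : (2 : ℤ) ^ K ∣ R := by rw [h]; exact_mod_cast padicValInt_dvd (p := 2) R
  have hodd : ∀ {S S' : ℤ}, S ≠ 0 → padicValInt 2 S = K → S = 2 ^ K * S' → ¬ (2 : ℤ) ∣ S' := by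
    intro S S' hS hv hSS' h2
    have hdvd : ((2 : ℕ) : ℤ) ^ (K + 1) ∣ S := by
      obtain ⟨c, hc⟩ := h2
      exact ⟨c, by rw [hSS', hc]; push_cast; ring⟩
    rcases (padicValInt_dvd_iff (p := 2) (K + 1) S).mp hdvd with h0 | hle
    · exact hS h0
    · rw [hv] at hle; omega
  have hP'odd : Odd P' := Int.not_even_iff_odd.mp (fun hev ↦ hodd hP rfl hP' (even_iff_two_dvd.mp hev))
  have hR'odd : Odd R' := Int.not_even_iff_odd.mp (fun hev ↦ hodd hR h.symm hR' (even_iff_two_dvd.mp hev))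
  obtain ⟨c, hc⟩ : (2 : ℤ) ∣ P' + R' := even_iff_two_dvd.mp (hP'odd.add_odd hR'odd)
  have hdvd : ((2 : ℕ) : ℤ) ^ (K + 1) ∣ P + R := ⟨c, by rw [hP', hR', ← mul_add, hc]; push_cast; ring⟩
  rcases (padicValInt_dvd_iff (p := 2) (K + 1) (P + R)).mp hdvd with h0 | hle
  · exact absurd h0 hPR
  · exact_mod_cast hle

/-- **«unit + unit is even» for rationals at `p = 2`**: if `v₂ x = v₂ y` and `x + y ≠ 0` then `v₂(x + y) ≥ v₂ x + 1`. -/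
theorem padicValRat_add_of_eq {x y : ℚ} (hx : x ≠ 0) (hy : y ≠ 0) (hxy : x + y ≠ 0)
    (h : padicValRat 2 x = padicValRat 2 y) : padicValRat 2 x + 1 ≤ padicValRat 2 (x + y) := by
  have hd₁ : (x.den : ℤ) ≠ 0 := by exact_mod_cast x.den_ne_zero
  have hd₂ : (y.den : ℤ) ≠ 0 := by exact_mod_cast y.den_ne_zero
  have hn₁ : x.num ≠ 0 := Rat.num_ne_zero.mpr hx
  have hn₂ : y.num ≠ 0 := Rat.num_ne_zero.mpr hy
  have ex : x = (x.num : ℚ) / ((x.den : ℤ) : ℚ) := by push_cast; exact (Rat.num_div_den x).symm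
  have ey : y = (y.num : ℚ) / ((y.den : ℤ) : ℚ) := by push_cast; exact (Rat.num_div_den y).symm
  have hd₁Q : ((x.den : ℤ) : ℚ) ≠ 0 := by exact_mod_cast hd₁
  have hd₂Q : ((y.den : ℤ) : ℚ) ≠ 0 := by exact_mod_cast hd₂
  have esum : x + y = ((x.num * y.den + y.num * x.den : ℤ) : ℚ) / (((x.den : ℤ) * y.den : ℤ) : ℚ) := by
    conv_lhs => rw [ex, ey]
    rw [div_add_div _ _ hd₁Q hd₂Q]; push_cast; ring
  have hS : x.num * y.den + y.num * x.den ≠ 0 := by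
    intro h0; apply hxy; rw [esum, h0]; simp
  have hvx : padicValRat 2 x = padicValInt 2 x.num - padicValInt 2 (x.den : ℤ) := by
    conv_lhs => rw [ex]
    rw [padicValRat.div (by exact_mod_cast hn₁) hd₁Q, padicValRat.of_int, padicValRat.of_int]
  have hvy : padicValRat 2 y = padicValInt 2 y.num - padicValInt 2 (y.den : ℤ) := by
    conv_lhs => rw [ey]
    rw [padicValRat.div (by exact_mod_cast hn₂) hd₂Q, padicValRat.of_int, padicValRat.of_int]
  have hvs : padicValRat 2 (x + y) = padicValInt 2 (x.num * y.den + y.num * x.den) - padicValInt 2 ((x.den : ℤ) * y.den) := by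
    rw [esum, padicValRat.div (by exact_mod_cast hS) (by exact_mod_cast mul_ne_zero hd₁ hd₂), padicValRat.of_int,
      padicValRat.of_int]
  have hPeq : padicValInt 2 (x.num * y.den) = padicValInt 2 (y.num * x.den) := by
    rw [padicValInt.mul hn₁ hd₂, padicValInt.mul hn₂ hd₁]
    have := h; rw [hvx, hvy] at this; omega
  have hle := padicValInt_add_of_eq (mul_ne_zero hn₁ hd₂) (mul_ne_zero hn₂ hd₁) hS hPeq
  rw [hvs, hvx, padicValInt.mul hd₁ hd₂]
  have h1 : padicValInt 2 (x.num * y.den) = padicValInt 2 x.num + padicValInt 2 (y.den : ℤ) := padicValInt.mul hn₁ hd₂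
  push_cast
  omega

/-- Hence two rationals of `2`-adic valuation `k` sum to `0` or to valuation `≥ k + 1`. -/
theorem padicValRat_add_of_eq' {x y : ℚ} (hx : x ≠ 0) (hy : y ≠ 0) (h : padicValRat 2 x = padicValRat 2 y) :
    x + y = 0 ∨ padicValRat 2 x + 1 ≤ padicValRat 2 (x + y) := by
  by_cases hxy : x + y = 0
  · exact Or.inl hxy
  · exact Or.inr (padicValRat_add_of_eq hx hy hxy h)

end UnitSum

/-! ## §2 The DEGENERATE row: `v₂ a = 0`, `v₂ b = 1`, `Δ ≥ 7`, member `t₀ + 2^m` -/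

section Degenerate

variable {a b : ℚ}

/-- `Q(t₀ + δ) = 3aδ² − D/(4a)` (`Q′(t₀) = 0`). -/
theorem Q_t0_add (ha : a ≠ 0) (δ : ℚ) :
    3 * a * (-3 * b / (2 * a) + δ) ^ 2 + 9 * b * (-3 * b / (2 * a) + δ) - a ^ 2 =
      3 * a * δ ^ 2 + -((4 * a ^ 3 + 27 * b ^ 2) / (4 * a)) := by
  field_simp; ring

/-- `f(t₀ + δ) = δ²(3t₀ + δ) + D(2aδ − b)/(8a³)`. -/
theorem f_t0_add (ha : a ≠ 0) (δ : ℚ) :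
    (-3 * b / (2 * a) + δ) ^ 3 + a * (-3 * b / (2 * a) + δ) + b =
      δ ^ 2 * (-(9 * b / (2 * a)) + δ) + (4 * a ^ 3 + 27 * b ^ 2) * (2 * a * δ - b) / (8 * a ^ 3) := by
  field_simp; ring

/-- **DEGENERATE ROW.** `v₂ a = 0`, `v₂ b = 1`, `Δ = v₂(4a³ + 27b²) ≥ 7`: the member `t = t₀ + 2^m` with `2m = Δ − 6` (even `Δ`,
value `2`) or `2m = Δ − 3` (odd `Δ`, value `5`) is in the window. -/
theorem exists_pencil_window_of_degenerate (ha : a ≠ 0) (hb : b ≠ 0) (hA : padicValRat 2 a = 0) (hB : padicValRat 2 b = 1)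
    (hD : 4 * a ^ 3 + 27 * b ^ 2 ≠ 0) (hΔ : 7 ≤ padicValRat 2 (4 * a ^ 3 + 27 * b ^ 2)) :
    ∃ t : ℚ, 3 * a * t ^ 2 + 9 * b * t - a ^ 2 ≠ 0 ∧ t ^ 3 + a * t + b ≠ 0 ∧
      padicValRat 2 (256 * (3 * a * t ^ 2 + 9 * b * t - a ^ 2) ^ 3 / ((4 * a ^ 3 + 27 * b ^ 2) * (t ^ 3 + a * t + b) ^ 2)) ∈
        ({1, 2, 5, 7, 8, 9, 10, 11} : Finset ℤ) := by
  set D := 4 * a ^ 3 + 27 * b ^ 2 with hDdef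
  set Δ := padicValRat 2 D with hΔdef
  -- choose `m ≥ 1` with `2m < Δ − 2` and `8 + 2m − Δ ∈ {2, 5}`
  obtain ⟨m, hm1, hmΔ, hval⟩ : ∃ m : ℕ, 1 ≤ m ∧ 2 * (m : ℤ) < Δ - 2 ∧ (8 + 2 * (m : ℤ) - Δ = 2 ∨ 8 + 2 * (m : ℤ) - Δ = 5) := by
    rcases Int.even_or_odd' Δ with ⟨k, hk | hk⟩
    · refine ⟨(k - 3).toNat, ?_, ?_, ?_⟩ <;> omega
    · refine ⟨(k - 1).toNat, ?_, ?_, ?_⟩ <;> omega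
  set δ : ℚ := 2 ^ m with hδdef
  have hδ0 : δ ≠ 0 := pow_ne_zero m two_ne_zero
  have hvδ : padicValRat 2 δ = m := by rw [hδdef, padicValRat.pow, padicValRat_two_2]; ring
  refine ⟨-3 * b / (2 * a) + δ, ?_⟩
  rw [Q_t0_add ha, f_t0_add ha]
  -- `v₂ Q = 2m`
  have h3aδ : padicValRat 2 (3 * a * δ ^ 2) = 2 * m := by
    rw [padicValRat.mul (mul_ne_zero (by norm_num) ha) (pow_ne_zero 2 hδ0), padicValRat.mul (by norm_num) ha, padicValRat.pow,
      padicValRat_two_3, hA, hvδ]; ring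
  have h3aδne : 3 * a * δ ^ 2 ≠ 0 := mul_ne_zero (mul_ne_zero (by norm_num) ha) (pow_ne_zero 2 hδ0)
  have hD4a : padicValRat 2 (-(D / (4 * a))) = Δ - 2 := by
    rw [padicValRat.neg, padicValRat.div hD (mul_ne_zero (by norm_num) ha), padicValRat.mul (by norm_num) ha, padicValRat_two_4,
      hA]; ring
  have hQlt : padicValRat 2 (3 * a * δ ^ 2) < padicValRat 2 (-(D / (4 * a))) := by rw [h3aδ, hD4a]; exact hmΔ
  have hvQ : padicValRat 2 (3 * a * δ ^ 2 + -(D / (4 * a))) = 2 * m := by rw [padicValRat_add_eq_of_lt h3aδne hQlt, h3aδ]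
  have hQne : 3 * a * δ ^ 2 + -(D / (4 * a)) ≠ 0 := add_ne_zero_of_padicValRat_lt hQlt
  -- `v₂ f = 2m`
  have h9b : padicValRat 2 (-(9 * b / (2 * a))) = 0 := by
    rw [padicValRat.neg, padicValRat.div (mul_ne_zero (by norm_num) hb) (mul_ne_zero (by norm_num) ha),
      padicValRat.mul (by norm_num) hb, padicValRat.mul (by norm_num) ha, padicValRat_two_9, padicValRat_two_2, hA, hB]; ring
  have h9bne : -(9 * b / (2 * a)) ≠ 0 := neg_ne_zero.mpr (div_ne_zero (mul_ne_zero (by norm_num) hb) (mul_ne_zero (by norm_num) ha))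
  have hinner : padicValRat 2 (-(9 * b / (2 * a)) + δ) = 0 := by
    rw [padicValRat_add_eq_of_lt h9bne (by rw [h9b, hvδ]; exact_mod_cast hm1), h9b]
  have hinnerne : -(9 * b / (2 * a)) + δ ≠ 0 := add_ne_zero_of_padicValRat_lt (by rw [h9b, hvδ]; exact_mod_cast hm1)
  have hT1 : padicValRat 2 (δ ^ 2 * (-(9 * b / (2 * a)) + δ)) = 2 * m := by
    rw [padicValRat.mul (pow_ne_zero 2 hδ0) hinnerne, padicValRat.pow, hvδ, hinner]; ring
  have hT1ne : δ ^ 2 * (-(9 * b / (2 * a)) + δ) ≠ 0 := mul_ne_zero (pow_ne_zero 2 hδ0) hinnerne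
  have h2aδ : padicValRat 2 (2 * a * δ) = 1 + m := by
    rw [padicValRat.mul (mul_ne_zero (by norm_num) ha) hδ0, padicValRat.mul (by norm_num) ha, padicValRat_two_2, hA, hvδ]; ring
  have hlin : padicValRat 2 (2 * a * δ - b) = 1 := by
    rw [sub_eq_add_neg, padicValRat_add_eq_of_lt' (neg_ne_zero.mpr hb) (by rw [padicValRat.neg, hB, h2aδ]; omega),
      padicValRat.neg, hB]
  have hlinne : 2 * a * δ - b ≠ 0 := by
    rw [sub_eq_add_neg]; exact add_ne_zero_of_padicValRat_lt' (by rw [padicValRat.neg, hB, h2aδ]; omega)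
  have hT2 : padicValRat 2 (D * (2 * a * δ - b) / (8 * a ^ 3)) = Δ - 2 := by
    rw [padicValRat.div (mul_ne_zero hD hlinne) (mul_ne_zero (by norm_num) (pow_ne_zero 3 ha)), padicValRat.mul hD hlinne,
      padicValRat.mul (by norm_num) (pow_ne_zero 3 ha), padicValRat.pow, padicValRat_two_8, hA, hlin]; ring
  have hflt : padicValRat 2 (δ ^ 2 * (-(9 * b / (2 * a)) + δ)) < padicValRat 2 (D * (2 * a * δ - b) / (8 * a ^ 3)) := by
    rw [hT1, hT2]; exact hmΔ
  have hvf : padicValRat 2 (δ ^ 2 * (-(9 * b / (2 * a)) + δ) + D * (2 * a * δ - b) / (8 * a ^ 3)) = 2 * m := by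
    rw [padicValRat_add_eq_of_lt hT1ne hflt, hT1]
  have hfne : δ ^ 2 * (-(9 * b / (2 * a)) + δ) + D * (2 * a * δ - b) / (8 * a ^ 3) ≠ 0 := add_ne_zero_of_padicValRat_lt hflt
  refine ⟨hQne, hfne, ?_⟩
  rw [padicValRat_pencilValue hQne hD hfne, hvQ, hvf]
  rcases hval with hv | hv
  · have : 8 + 3 * (2 * (m : ℤ)) - Δ - 2 * (2 * (m : ℤ)) = 2 := by omega
    rw [this]; decide
  · have : 8 + 3 * (2 * (m : ℤ)) - Δ - 2 * (2 * (m : ℤ)) = 5 := by omega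
    rw [this]; decide

end Degenerate

/-! ## §3 The ISOLATED-ROOT row: `v₂ b = 0`, `a = 0 ∨ v₂ a ≥ 2`, an odd `t ≤ 15` with `v₂ f(t) = 3` -/

section IsolatedRoot

variable {a b : ℚ}

/-- Valuation of an odd integer: `v₂ (2s + 1) = 0`. -/
theorem padicValRat_odd_int (s : ℤ) : padicValRat 2 ((2 * s + 1 : ℤ) : ℚ) = 0 := by
  rw [padicValRat.of_int]
  have : ¬ ((2 : ℕ) : ℤ) ∣ 2 * s + 1 := by
    intro ⟨c, hc⟩; omega
  exact_mod_cast padicValInt.eq_zero_of_not_dvd this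

/-- For odd `t` and `a` with `a = 0 ∨ v₂ a ≥ 2`: the step `f(t + e) − f(t) = e·(3t² + 3te + e² + a)` has the second factor
a `2`-adic unit when `v₂ e ≥ 1`. -/
theorem padicValRat_step_factor (haA : a = 0 ∨ (a ≠ 0 ∧ 2 ≤ padicValRat 2 a)) (s : ℤ) {e : ℚ} (he : e ≠ 0)
    (hve : 1 ≤ padicValRat 2 e) :
    padicValRat 2 (3 * ((2 * s + 1 : ℤ) : ℚ) ^ 2 + (3 * ((2 * s + 1 : ℤ) : ℚ) * e + e ^ 2 + a)) = 0 ∧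
      3 * ((2 * s + 1 : ℤ) : ℚ) ^ 2 + (3 * ((2 * s + 1 : ℤ) : ℚ) * e + e ^ 2 + a) ≠ 0 := by
  set t : ℚ := ((2 * s + 1 : ℤ) : ℚ) with htdef
  have ht0 : t ≠ 0 := by rw [htdef]; exact_mod_cast (by omega : (2 * s + 1 : ℤ) ≠ 0)
  have hvt : padicValRat 2 t = 0 := padicValRat_odd_int s
  have h3t2 : padicValRat 2 (3 * t ^ 2) = 0 := by
    rw [padicValRat.mul (by norm_num) (pow_ne_zero 2 ht0), padicValRat.pow, padicValRat_two_3, hvt]; ring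
  have h3t2ne : 3 * t ^ 2 ≠ 0 := mul_ne_zero (by norm_num) (pow_ne_zero 2 ht0)
  -- the rest `3te + e² + a` is `0` or has positive valuation
  have hrest : 3 * t * e + e ^ 2 + a = 0 ∨ 1 ≤ padicValRat 2 (3 * t * e + e ^ 2 + a) := by
    have h3te : padicValRat 2 (3 * t * e) = padicValRat 2 e := by
      rw [padicValRat.mul (mul_ne_zero (by norm_num) ht0) he, padicValRat.mul (by norm_num) ht0, padicValRat_two_3, hvt]; ring
    have he2 : padicValRat 2 (e ^ 2) = 2 * padicValRat 2 e := by rw [padicValRat.pow]; ring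
    have hfirst : 1 ≤ padicValRat 2 (3 * t * e + e ^ 2) ∧ 3 * t * e + e ^ 2 ≠ 0 := by
      have hlt : padicValRat 2 (3 * t * e) < padicValRat 2 (e ^ 2) := by rw [h3te, he2]; omega
      exact ⟨by rw [padicValRat_add_eq_of_lt (mul_ne_zero (mul_ne_zero (by norm_num) ht0) he) hlt, h3te]; exact hve,
        add_ne_zero_of_padicValRat_lt hlt⟩
    rcases haA with ha0 | ⟨ha, hA⟩
    · right; rw [ha0, add_zero]; exact hfirst.1
    · by_cases hsum : 3 * t * e + e ^ 2 + a = 0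
      · exact Or.inl hsum
      · right
        have := padicValRat.min_le_padicValRat_add (p := 2) hsum
        have h1 := hfirst.1
        omega
  rcases hrest with h0 | hpos
  · rw [h0, add_zero]; exact ⟨h3t2, h3t2ne⟩
  · have hlt : padicValRat 2 (3 * t ^ 2) < padicValRat 2 (3 * t * e + e ^ 2 + a) := by rw [h3t2]; omega
    exact ⟨by rw [padicValRat_add_eq_of_lt h3t2ne hlt, h3t2], add_ne_zero_of_padicValRat_lt hlt⟩

/-- **The isometry step**: for odd `t = 2s + 1`, `e = 2^k` (`k ≥ 1`): `f(t + e) = f(t) + e·u` with `v₂(e·u) = k`. So if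
`v₂ f(t) = k` then `f(t + e) = 0` or `v₂ f(t + e) ≥ k + 1`; if `f(t) = 0` or `v₂ f(t) > k` then `v₂ f(t + e) = k`. -/
theorem f_step (haA : a = 0 ∨ (a ≠ 0 ∧ 2 ≤ padicValRat 2 a)) (s : ℤ) (k : ℕ) (hk : 1 ≤ k) :
    let t : ℚ := ((2 * s + 1 : ℤ) : ℚ)
    let e : ℚ := 2 ^ k
    (∃ u : ℚ, u ≠ 0 ∧ padicValRat 2 (e * u) = k ∧ (t + e) ^ 3 + a * (t + e) + b = (t ^ 3 + a * t + b) + e * u) := by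
  intro t e
  have he : e ≠ 0 := pow_ne_zero k two_ne_zero
  have hve : padicValRat 2 e = k := by show padicValRat 2 ((2 : ℚ) ^ k) = k; rw [padicValRat.pow, padicValRat_two_2]; ring
  obtain ⟨hu, hune⟩ := padicValRat_step_factor haA s he (by rw [hve]; exact_mod_cast hk)
  refine ⟨3 * t ^ 2 + (3 * t * e + e ^ 2 + a), hune, ?_, by ring⟩
  rw [padicValRat.mul he hune, hve, hu]; ring

/-- Walking up: from an odd `t` with `v₂ f(t) = k ∈ {1, 2}` to the odd `t + 2^k` with `f = 0` or `v₂ f ≥ k + 1`. -/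
theorem f_walk_up (haA : a = 0 ∨ (a ≠ 0 ∧ 2 ≤ padicValRat 2 a)) (s : ℤ) (k : ℕ) (hk : 1 ≤ k)
    (hf : ((2 * s + 1 : ℤ) : ℚ) ^ 3 + a * ((2 * s + 1 : ℤ) : ℚ) + b ≠ 0)
    (hv : padicValRat 2 (((2 * s + 1 : ℤ) : ℚ) ^ 3 + a * ((2 * s + 1 : ℤ) : ℚ) + b) = k) :
    ∃ s' : ℤ, (((2 * s' + 1 : ℤ) : ℚ) ^ 3 + a * ((2 * s' + 1 : ℤ) : ℚ) + b = 0 ∨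
      (k : ℤ) + 1 ≤ padicValRat 2 (((2 * s' + 1 : ℤ) : ℚ) ^ 3 + a * ((2 * s' + 1 : ℤ) : ℚ) + b)) := by
  obtain ⟨u, hune, hvu, hstep⟩ := f_step (b := b) haA s k hk
  refine ⟨s + 2 ^ (k - 1), ?_⟩
  have ht' : ((2 * (s + 2 ^ (k - 1)) + 1 : ℤ) : ℚ) = ((2 * s + 1 : ℤ) : ℚ) + 2 ^ k := by
    push_cast
    have : (2 : ℚ) ^ k = 2 * 2 ^ (k - 1) := by rw [← pow_succ']; congr 1; omega
    rw [this]; ring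
  rw [ht', hstep]
  have heu : (2 : ℚ) ^ k * u ≠ 0 := mul_ne_zero (pow_ne_zero k two_ne_zero) hune
  rcases padicValRat_add_of_eq' hf heu (by rw [hv, hvu]) with h0 | hle
  · exact Or.inl h0
  · right; rw [hv] at hle; exact hle

/-- Finishing: from an odd `t` with `f(t) = 0` or `v₂ f(t) ≥ 4` to the odd `t + 8` with `v₂ f = 3` exactly. -/
theorem f_finish (haA : a = 0 ∨ (a ≠ 0 ∧ 2 ≤ padicValRat 2 a)) (s : ℤ)
    (h : ((2 * s + 1 : ℤ) : ℚ) ^ 3 + a * ((2 * s + 1 : ℤ) : ℚ) + b = 0 ∨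
      4 ≤ padicValRat 2 (((2 * s + 1 : ℤ) : ℚ) ^ 3 + a * ((2 * s + 1 : ℤ) : ℚ) + b)) :
    ∃ s' : ℤ, ((2 * s' + 1 : ℤ) : ℚ) ^ 3 + a * ((2 * s' + 1 : ℤ) : ℚ) + b ≠ 0 ∧
      padicValRat 2 (((2 * s' + 1 : ℤ) : ℚ) ^ 3 + a * ((2 * s' + 1 : ℤ) : ℚ) + b) = 3 := by
  obtain ⟨u, hune, hvu, hstep⟩ := f_step (b := b) haA s 3 (by norm_num)
  refine ⟨s + 4, ?_⟩
  have ht' : ((2 * (s + 4) + 1 : ℤ) : ℚ) = ((2 * s + 1 : ℤ) : ℚ) + 2 ^ 3 := by push_cast; ring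
  rw [ht', hstep]
  have heu : (2 : ℚ) ^ 3 * u ≠ 0 := mul_ne_zero (pow_ne_zero 3 two_ne_zero) hune
  rcases h with h0 | h4
  · rw [h0, zero_add]; exact ⟨heu, by exact_mod_cast hvu⟩
  · have hlt : padicValRat 2 ((2 : ℚ) ^ 3 * u) <
        padicValRat 2 (((2 * s + 1 : ℤ) : ℚ) ^ 3 + a * ((2 * s + 1 : ℤ) : ℚ) + b) := by rw [hvu]; omega
    exact ⟨add_ne_zero_of_padicValRat_lt' hlt, by rw [padicValRat_add_eq_of_lt' heu hlt]; exact_mod_cast hvu⟩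

/-- Start: `f(1) = 0` or `v₂ f(1) ≥ 1` (`1 + b` is «unit + unit», `a` is `0` or of valuation `≥ 2`). -/
theorem f_one (hb : b ≠ 0) (hB : padicValRat 2 b = 0) (haA : a = 0 ∨ (a ≠ 0 ∧ 2 ≤ padicValRat 2 a)) :
    ((2 * (0 : ℤ) + 1 : ℤ) : ℚ) ^ 3 + a * ((2 * (0 : ℤ) + 1 : ℤ) : ℚ) + b = 0 ∨
      1 ≤ padicValRat 2 (((2 * (0 : ℤ) + 1 : ℤ) : ℚ) ^ 3 + a * ((2 * (0 : ℤ) + 1 : ℤ) : ℚ) + b) := by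
  have h1 : ((2 * (0 : ℤ) + 1 : ℤ) : ℚ) ^ 3 + a * ((2 * (0 : ℤ) + 1 : ℤ) : ℚ) + b = (1 + b) + a := by push_cast; ring
  rw [h1]
  have h1b : 1 + b = 0 ∨ 1 ≤ padicValRat 2 (1 + b) := by
    rcases padicValRat_add_of_eq' one_ne_zero hb (by rw [padicValRat.one, hB]) with h0 | hle
    · exact Or.inl h0
    · right; rw [padicValRat.one] at hle; omega
  rcases haA with ha0 | ⟨ha, hA⟩
  · rw [ha0, add_zero]; exact h1b
  · rcases h1b with h0 | hle
    · right; rw [h0, zero_add]; omega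
    · by_cases hsum : 1 + b + a = 0
      · exact Or.inl hsum
      · right
        have := padicValRat.min_le_padicValRat_add (p := 2) hsum
        omega

/-- **There is an odd `t` with `v₂ f(t) = 3`** (`v₂ b = 0`, `a = 0 ∨ v₂ a ≥ 2`): walk `1 → +2 → +4 → +8` as needed. -/
theorem exists_odd_padicValRat_f_eq_three (hb : b ≠ 0) (hB : padicValRat 2 b = 0)
    (haA : a = 0 ∨ (a ≠ 0 ∧ 2 ≤ padicValRat 2 a)) :
    ∃ s : ℤ, ((2 * s + 1 : ℤ) : ℚ) ^ 3 + a * ((2 * s + 1 : ℤ) : ℚ) + b ≠ 0 ∧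
      padicValRat 2 (((2 * s + 1 : ℤ) : ℚ) ^ 3 + a * ((2 * s + 1 : ℤ) : ℚ) + b) = 3 := by
  -- generic dispatcher: from `f = 0 ∨ v ≥ 1` at some odd `t`, reach `v = 3`
  have climb : ∀ s : ℤ, (((2 * s + 1 : ℤ) : ℚ) ^ 3 + a * ((2 * s + 1 : ℤ) : ℚ) + b = 0 ∨
      1 ≤ padicValRat 2 (((2 * s + 1 : ℤ) : ℚ) ^ 3 + a * ((2 * s + 1 : ℤ) : ℚ) + b)) →
      ∃ s' : ℤ, ((2 * s' + 1 : ℤ) : ℚ) ^ 3 + a * ((2 * s' + 1 : ℤ) : ℚ) + b ≠ 0 ∧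
        padicValRat 2 (((2 * s' + 1 : ℤ) : ℚ) ^ 3 + a * ((2 * s' + 1 : ℤ) : ℚ) + b) = 3 := by
    -- from level `≥ 2`
    have climb2 : ∀ s : ℤ, (((2 * s + 1 : ℤ) : ℚ) ^ 3 + a * ((2 * s + 1 : ℤ) : ℚ) + b = 0 ∨
        2 ≤ padicValRat 2 (((2 * s + 1 : ℤ) : ℚ) ^ 3 + a * ((2 * s + 1 : ℤ) : ℚ) + b)) →
        ∃ s' : ℤ, ((2 * s' + 1 : ℤ) : ℚ) ^ 3 + a * ((2 * s' + 1 : ℤ) : ℚ) + b ≠ 0 ∧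
          padicValRat 2 (((2 * s' + 1 : ℤ) : ℚ) ^ 3 + a * ((2 * s' + 1 : ℤ) : ℚ) + b) = 3 := by
      -- from level `≥ 3`
      have climb3 : ∀ s : ℤ, (((2 * s + 1 : ℤ) : ℚ) ^ 3 + a * ((2 * s + 1 : ℤ) : ℚ) + b = 0 ∨
          3 ≤ padicValRat 2 (((2 * s + 1 : ℤ) : ℚ) ^ 3 + a * ((2 * s + 1 : ℤ) : ℚ) + b)) →
          ∃ s' : ℤ, ((2 * s' + 1 : ℤ) : ℚ) ^ 3 + a * ((2 * s' + 1 : ℤ) : ℚ) + b ≠ 0 ∧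
            padicValRat 2 (((2 * s' + 1 : ℤ) : ℚ) ^ 3 + a * ((2 * s' + 1 : ℤ) : ℚ) + b) = 3 := by
        intro s h
        rcases h with h0 | h3
        · exact f_finish haA s (Or.inl h0)
        · by_cases h3eq : padicValRat 2 (((2 * s + 1 : ℤ) : ℚ) ^ 3 + a * ((2 * s + 1 : ℤ) : ℚ) + b) = 3
          · by_cases hz : ((2 * s + 1 : ℤ) : ℚ) ^ 3 + a * ((2 * s + 1 : ℤ) : ℚ) + b = 0
            · exact f_finish haA s (Or.inl hz)
            · exact ⟨s, hz, h3eq⟩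
          · exact f_finish haA s (Or.inr (by omega))
      intro s h
      rcases h with h0 | h2
      · exact f_finish haA s (Or.inl h0)
      · by_cases h2eq : padicValRat 2 (((2 * s + 1 : ℤ) : ℚ) ^ 3 + a * ((2 * s + 1 : ℤ) : ℚ) + b) = 2
        · by_cases hz : ((2 * s + 1 : ℤ) : ℚ) ^ 3 + a * ((2 * s + 1 : ℤ) : ℚ) + b = 0
          · exact f_finish haA s (Or.inl hz)
          · obtain ⟨s', hs'⟩ := f_walk_up haA s 2 (by norm_num) hz (by exact_mod_cast h2eq)
            exact climb3 s' (by rcases hs' with h | h; exact Or.inl h; exact Or.inr (by exact_mod_cast h))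
        · exact climb3 s (Or.inr (by omega))
    intro s h
    rcases h with h0 | h1
    · exact f_finish haA s (Or.inl h0)
    · by_cases h1eq : padicValRat 2 (((2 * s + 1 : ℤ) : ℚ) ^ 3 + a * ((2 * s + 1 : ℤ) : ℚ) + b) = 1
      · by_cases hz : ((2 * s + 1 : ℤ) : ℚ) ^ 3 + a * ((2 * s + 1 : ℤ) : ℚ) + b = 0
        · exact f_finish haA s (Or.inl hz)
        · obtain ⟨s', hs'⟩ := f_walk_up haA s 1 (by norm_num) hz (by exact_mod_cast h1eq)
          exact climb2 s' (by rcases hs' with h | h; exact Or.inl h; exact Or.inr (by exact_mod_cast h))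
      · exact climb2 s (Or.inr (by omega))
  exact climb 0 (f_one hb hB haA)

/-- **ISOLATED-ROOT ROW.** `v₂ b = 0` and (`a = 0` or `v₂ a ≥ 2`): an odd `t` with `v₂ f(t) = 3` has `v₂ Q(t) = 0`, `Δ = 0`,
value `8 − 6 = 2` — a window member. -/
theorem exists_pencil_window_of_isolatedRoot (hb : b ≠ 0) (hB : padicValRat 2 b = 0)
    (haA : a = 0 ∨ (a ≠ 0 ∧ 2 ≤ padicValRat 2 a)) :
    ∃ t : ℚ, 3 * a * t ^ 2 + 9 * b * t - a ^ 2 ≠ 0 ∧ t ^ 3 + a * t + b ≠ 0 ∧ 4 * a ^ 3 + 27 * b ^ 2 ≠ 0 ∧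
      padicValRat 2 (256 * (3 * a * t ^ 2 + 9 * b * t - a ^ 2) ^ 3 / ((4 * a ^ 3 + 27 * b ^ 2) * (t ^ 3 + a * t + b) ^ 2)) ∈
        ({1, 2, 5, 7, 8, 9, 10, 11} : Finset ℤ) := by
  obtain ⟨s, hfne, hvf⟩ := exists_odd_padicValRat_f_eq_three hb hB haA
  set t : ℚ := ((2 * s + 1 : ℤ) : ℚ) with htdef
  have ht0 : t ≠ 0 := by rw [htdef]; exact_mod_cast (by omega : (2 * s + 1 : ℤ) ≠ 0)
  have hvt : padicValRat 2 t = 0 := padicValRat_odd_int s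
  -- `Δ = 0`
  have hΔD : padicValRat 2 (4 * a ^ 3 + 27 * b ^ 2) = 0 ∧ 4 * a ^ 3 + 27 * b ^ 2 ≠ 0 := by
    rcases haA with ha0 | ⟨ha, hA⟩
    · have := padicValRat_D_eq_of_a_eq_zero ha0 hb; rw [hB] at this; simpa using this
    · have := padicValRat_D_eq_of_lt_left ha hb (by rw [hB]; omega); rw [hB] at this; simpa using this
  obtain ⟨hΔ, hD⟩ := hΔD
  -- `v₂ Q(t) = 0`: `Q = 9bt + (3at² − a²)`
  have h9bt : padicValRat 2 (9 * b * t) = 0 := by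
    rw [padicValRat.mul (mul_ne_zero (by norm_num) hb) ht0, padicValRat.mul (by norm_num) hb, padicValRat_two_9, hB, hvt]; ring
  have h9btne : 9 * b * t ≠ 0 := mul_ne_zero (mul_ne_zero (by norm_num) hb) ht0
  have hQeq : 3 * a * t ^ 2 + 9 * b * t - a ^ 2 = 9 * b * t + (3 * a * t ^ 2 - a ^ 2) := by ring
  have hrest : 3 * a * t ^ 2 - a ^ 2 = 0 ∨ padicValRat 2 (9 * b * t) < padicValRat 2 (3 * a * t ^ 2 - a ^ 2) := by
    rcases haA with ha0 | ⟨ha, hA⟩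
    · left; rw [ha0]; ring
    · right
      have h3at : padicValRat 2 (3 * a * t ^ 2) = padicValRat 2 a := by
        rw [padicValRat.mul (mul_ne_zero (by norm_num) ha) (pow_ne_zero 2 ht0), padicValRat.mul (by norm_num) ha, padicValRat.pow,
          padicValRat_two_3, hvt]; ring
      have haa : padicValRat 2 (-a ^ 2) = 2 * padicValRat 2 a := by rw [padicValRat.neg, padicValRat.pow]; ring
      rw [sub_eq_add_neg, padicValRat_add_eq_of_lt (mul_ne_zero (mul_ne_zero (by norm_num) ha) (pow_ne_zero 2 ht0))
        (by rw [h3at, haa]; omega), h3at, h9bt]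
      omega
  have hvQ : padicValRat 2 (3 * a * t ^ 2 + 9 * b * t - a ^ 2) = 0 ∧ 3 * a * t ^ 2 + 9 * b * t - a ^ 2 ≠ 0 := by
    rw [hQeq]
    rcases hrest with h0 | hlt
    · rw [h0, add_zero]; exact ⟨h9bt, h9btne⟩
    · exact ⟨by rw [padicValRat_add_eq_of_lt h9btne hlt, h9bt], add_ne_zero_of_padicValRat_lt hlt⟩
  obtain ⟨hvQ, hQne⟩ := hvQ
  refine ⟨t, hQne, hfne, hD, ?_⟩
  rw [padicValRat_pencilValue hQne hD hfne, hvQ, hΔ, hvf]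
  decide

end IsolatedRoot

end Summit.BirchSwinnertonDyer.BirchSwinnertonDyer.Theorems.AddKatoTwo

end
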